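import Mathlib
import HarnessLib

/-!
# KreinLangerDefinitization

Topic `Literature/Analysis/OperatorTheory`. Named literature fact(s) relocated by the gate from `Summits/RiemannHypothesis/RiemannHypothesis/Theorems/RuelleBandCofiniteCriticalLineStubDefinitize.lean`
(accept-time relocation of `[cite]`d propositions written inline in a Summits proposal; human ruling 2026-08-15).
Sources: Stewart1972.

* `Literature.Analysis.OperatorTheory.KreinDefinitization`
-/

namespace Literature.Analysis.OperatorTheory

/-- **Kreĭn's definitization theorem for Hermitian functions with finitely many negative squares**
(M. G. Kreĭn, Dokl. Akad. Nauk SSSR 125 (1959) 31–34; J. Stewart, Canad. Math. Bull. 15 (1972),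
Thm. 3.1 with Thm. 2.4), smooth pointwise special case.

Printed statements.  A function `f : ℝ → ℂ` with `f(-x) = conj f(x)` *has `k` negative squares* if
the Hermitian form `Σ_{i,j} f(x_i - x_j) ξ_i ξ̄_j` has at most `k` negative squares for every choice
of `n` and `x_1, …, x_n ∈ ℝ`, and exactly `k` for some choice (Stewart 1972 §1, after Kreĭn).
Stewart, Thm. 2.4: *A continuous function `f` has `k` negative squares if and only if it is in
`P_k(C_c)`* (the same condition on the forms `∫∫ f(x-y) φ(x) φ̄(y) dx dy`, `φ` ranging over the span
of `φ_1, …, φ_n ∈ C_c(ℝ)`), and `P_k(C_c^∞) = P_k(C_c)` (§3).  Stewart, Thm. 3.1: *If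
`f ∈ P_k(C_c^∞)` then there is a polynomial `Q` of degree at most `k` such that
`∫∫ f(x-y) [Q(-i d/dx) φ](x) conj([Q(-i d/dy) φ](y)) dx dy ≥ 0` holds for every `φ ∈ C_c^∞`* — `Q`
is the minimal polynomial of the generator of translations restricted to a `k`-dimensional
non-positive invariant subspace of the Pontryagin space `Π_k` of `f` (Pontryagin's theorem), in
particular monic.  For continuous `f` this is Kreĭn's 1959 theorem: `f = h + ∫ (e^{iλx} - S(x,λ))
dσ(λ)/|Q(λ)|²` with `σ ≥ 0` and `Q(-i d/dx) Q̄(-i d/dx) h = 0` (quoted from Stewart 1972, §1,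
eq. (2)), so that `Q(-i d/dx) Q̄(-i d/dx) f = ∫ e^{iλx} dσ(λ)` is positive definite in the sense of
distributions (later expositions: M. G. Kreĭn, H. Langer, Math. Nachr. 77 (1977) 187–236, §§1–4;
Z. Sasvári, *Positive definite and definitizable functions*, Akademie Verlag 1994, Ch. 5).

Formalised special case (the one the tree consumes): `F` smooth; "at most `κ` negative squares"
is stated on point masses — for all `n`, `x : Fin n → ℝ` and any `κ + 1` coefficient vectors
`v_0, …, v_κ ∈ ℂⁿ` some non-trivial combination `d = Σ_i w_i v_i` has
`Re Σ_{k,l} d_k d̄_l F(x_k - x_l) ≥ 0` (no `(κ+1)`-dimensional subspace of `ℂⁿ` on which the form is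
negative definite); the conclusion is stated pointwise for the smooth kernel
`G := P(-iD) P♯(-iD) F = Σ_{j,m ≤ deg P} P_j conj(P_m) (-i)^{j+m} F^{(j+m)}` (`P♯(z) = conj P(z̄)`):
`Re Σ_{k,l} c_k c̄_l G(x_k - x_l) ≥ 0` for all `n`, `x`, `c`, with `P ≠ 0`, `deg P ≤ κ`.
Derivation from the printed theorems: `F` has `k' ≤ κ` negative squares, so `F ∈ P_{k'}(C_c^∞)`
(Thm. 2.4); Thm. 3.1 gives a monic `Q` with `deg Q ≤ k'`; since `F` is smooth, `2 deg Q`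
integrations by parts turn the displayed inequality into `∫∫ G(x-y) φ(x) φ̄(y) dx dy ≥ 0` for
`P(z) := Q(-z)`, i.e. the continuous function `G` lies in `P_0(C_c^∞) = P_0(C_c)` and is therefore
positive definite (Thm. 2.4, `k = 0`).  (The expression `G` is symmetric under `P ↔ P♯`, and the
sign convention `±i` is absorbed by `P(z) ↦ P(-z)`.)
[cite: Stewart1972, Thm. 3.1 with Thm. 2.4 (continuous case Krein1959)]
[file Analysis/OperatorTheory/KreinLangerDefinitization] -/
def KreinDefinitization : Prop :=
  ∀ (κ : ℕ) (F : ℝ → ℂ), ContDiff ℝ ((⊤ : ℕ∞) : WithTop ℕ∞) F →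
    (∀ x, F (-x) = (starRingEnd ℂ) (F x)) →
    (∀ (n : ℕ) (x : Fin n → ℝ) (v : Fin (κ + 1) → Fin n → ℂ), ∃ w : Fin (κ + 1) → ℂ, w ≠ 0 ∧
      0 ≤ (∑ k, ∑ l, (∑ i, w i * v i k) * (starRingEnd ℂ) (∑ i, w i * v i l) *
        F (x k - x l)).re) →
    ∃ P : Polynomial ℂ, P ≠ 0 ∧ P.natDegree ≤ κ ∧
      ∀ (n : ℕ) (x : Fin n → ℝ) (c : Fin n → ℂ),
        0 ≤ (∑ k, ∑ l, c k * (starRingEnd ℂ) (c l) *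
          ∑ j ∈ Finset.range (P.natDegree + 1), ∑ m ∈ Finset.range (P.natDegree + 1),
            P.coeff j * (starRingEnd ℂ) (P.coeff m) * (-Complex.I) ^ (j + m) *
              iteratedDeriv (j + m) F (x k - x l)).re
-- TODO(general form): Stewart 1972 Thm. 3.1 is stated for locally summable `f ∈ P_k(C_c^∞)` with the
-- distributional conclusion `∫∫ f(x-y) [Q(-iD)φ](x) conj([Q(-iD)φ](y)) dx dy ≥ 0`; Kreĭn 1959 gives,
-- for continuous `f`, the integral representation with a non-negative measure `σ`.

end Literature.Analysis.OperatorTheory
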